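import Summits.AtomisticToContinuum.Crystallization.Theorems.SpectralChargeLedgerSummedShellPricingSplit
import Summits.AtomisticToContinuum.Crystallization.Theorems.SpectralChargeLedgerSummedShellPricingTorusDivergence
import Summits.AtomisticToContinuum.Crystallization.Theorems.SpectralChargeLedgerSummedShellPricingCalibratedFloor

/-!
# K1 `SpectralChargeLedger.SummedShellPricing` (stmt-AtomisticToContinuum-17044), line `Sketch`, skeleton v3:
# the CALIBRATION REDUCTION, part 1/2 — the interior ledger from the calibrated site inequality (lead c1, 2026-08-17)

K1 follows from the hub crux `PhononSlackCertificates.CoerciveTwoShellGap` (stmt-13956) and ONE pointwise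
statement, the **calibrated site inequality at the box minimiser** (CSI, the registered residual stub
`stub_calibratedSiteInequality` of `Cruxes/SummedShellPricing/Lines/Sketch.lean`):

* `interiorLedgerAt_of_calibration` — CSI ∧ torus divergence ∧ calibrated floor ⇒ the interior relative ledger
  at every box minimiser `(a, h)` of `e(hcp ·,·)` (open box `9/10 < a < 1`, `|h − a√(2/3)| ≤ a/100`): summing
  the calibrated site energies `½Σ'V_LJ + Σ'g` over the motif of a periodic `P` gives `#motif·e(P)` EXACTLY
  (the divergence of the antisymmetric lattice-covariant flux vanishes on the torus,
  `SummedShellPricingTorusDivergence.stub_torusDivergence`, p172565), deep-good sites contribute `≥ e(hcp a h)`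
  (`+ κ` if τ-bad), every other motif site `≥ −C₀` (`SummedShellPricingCalibratedFloor.stub_calibratedFloor`,
  p172604);
* `interiorLedgerAt_of_calibratedSiteInequality` — the same with the two landed stubs discharged;
* `hcpRelativeLedger_of_interiorLedgerAt` — at the LANDED box minimiser (`HcpLandscapeGapBirth.stub_boxMinimiser`,
  enclosure `stub_boxMinimiserRigid` ⇒ K1's box `47/50 ≤ a ≤ 1`) and with the packing lemma
  `SummedShellPricingSpoiledByGross.stub_spoiledByGross` (p172384: motif sites within `R` of a two-shell-bad point
  are `≤ K`× the two-shell-bad motif sites), the interior ledger gives the e⋆-free relative ledger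
  `HcpRelativeLedger` (`c' = min c 1`, `C' = (C+1)K`);
* `summedShellPricing_of_coerciveTwoShellGap_of_calibratedSiteInequality` — with the landed split glue
  `SummedShellPricingSplit.SummedShellPricing_of_subs` (p169653: hub crux ∧ relative ledger ⇒ K1, through
  `e⋆ ≤ e(hcp)`, the torus glue p166291, the hub torus form p101526, periodisation p166315 and separation
  reduction p166632): **`CoerciveTwoShellGap → CSI → SummedShellPricing`**.

This file (part 1) holds the first two theorems; part 2 (`…CalibrationGlue.lean`) the last two.
All statements are written in the tree's vocabulary with the τ-goodness disjunction of K1 unfolded (no new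
definition).  CSI is the crux-sized residual (discrete null Lagrangian / atomistic stress at the zero-pressure
cell; cf. `Cruxes/HcpLandscapeGap/Lines/calibration.md`, whose stub ZA is its globally-templated special case).
-/

noncomputable section

namespace Summit.AtomisticToContinuum.Crystallization.Theorems.SummedShellPricingCalibration

open scoped BigOperators Classical
open Literature.MathematicalPhysics.StatisticalMechanics Literature.Geometry.DiscreteGeometry
open Summit.AtomisticToContinuum.Crystallization.Theorems

/-- **Composition of the calibration cut**: calibrated site inequality ∧ torus divergence ∧ calibrated
floor ⇒ the interior relative ledger at every box minimiser, with `c = κ(τ)` and allowance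
`C = C₀ + |e(hcp a h)|`. [folklore] -/
theorem interiorLedgerAt_of_calibration
    (hcal : ∀ (a h : ℝ) (ha : a ≠ 0) (hh : h ≠ 0), (9 / 10 < a ∧ a < 1 ∧ |h - a * Real.sqrt (2 / 3)| ≤ a / 100) →
      (∀ a' h' : ℝ, ∀ ha' : a' ≠ 0, ∀ hh' : h' ≠ 0, (9 / 10 < a' ∧ a' < 1 ∧ |h' - a' * Real.sqrt (2 / 3)| ≤ a' / 100) →
        (hcpPeriodicConfiguration ha hh).energyPerParticle lennardJones ≤
          (hcpPeriodicConfiguration ha' hh').energyPerParticle lennardJones) →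
      ∃ R : ℝ, 0 < R ∧ ∃ G : ℝ, 0 ≤ G ∧ ∀ τ : ℝ, 0 < τ → τ ≤ 1 → ∃ κ : ℝ, 0 < κ ∧
        ∀ S : Set (EuclideanSpace ℝ (Fin 3)), (∀ u ∈ S, ∀ v ∈ S, u ≠ v → (1 / 3 : ℝ) ≤ dist u v) →
          ∃ g : EuclideanSpace ℝ (Fin 3) → EuclideanSpace ℝ (Fin 3) → ℝ,
            (∀ y z, g y z = -g z y) ∧
            (∀ y z, |g y z| ≤ G * (dist y z)⁻¹ ^ 6) ∧
            (∀ v : EuclideanSpace ℝ (Fin 3), (∀ p, p + v ∈ S ↔ p ∈ S) → ∀ y z, g (y + v) (z + v) = g y z) ∧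
            (∀ y ∈ S, (∀ p ∈ S, dist p y ≤ R → IsTwoShellGoodSet (1 / 20) (47 / 50) 1 S p) →
                (hcpPeriodicConfiguration ha hh).energyPerParticle lennardJones
                  ≤ 1 / 2 * (∑' z : {z // z ∈ S ∧ z ≠ y}, lennardJones (dist y z.1))
                      + ∑' z : {z // z ∈ S ∧ z ≠ y}, g y z.1) ∧
            (∀ y ∈ S, (∀ p ∈ S, dist p y ≤ R → IsTwoShellGoodSet (1 / 20) (47 / 50) 1 S p) →
                ¬ (∃ A : EuclideanSpace ℝ (Fin 3) →ₗᵢ[ℝ] EuclideanSpace ℝ (Fin 3),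
                   (∃ e : ↥{z : EuclideanSpace ℝ (Fin 3) | z ∈ S ∧ z ≠ y ∧ dist z (y) < 13 / 10 * a} ≃
                       ↥{p : EuclideanSpace ℝ (Fin 3) | p ∈ hcpStacking a h ∧ p ≠ 0 ∧ ‖p‖ < 13 / 10 * a},
                     ∀ t : ↥{z : EuclideanSpace ℝ (Fin 3) | z ∈ S ∧ z ≠ y ∧ dist z (y) < 13 / 10 * a},
                       dist ((t : EuclideanSpace ℝ (Fin 3)) - y)
                         (A ((e t : ↥{p : EuclideanSpace ℝ (Fin 3) | p ∈ hcpStacking a h ∧ p ≠ 0 ∧ ‖p‖ < 13 / 10 * a}) : EuclideanSpace ℝ (Fin 3))) ≤ τ) ∨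
                   (∃ e : ↥{z : EuclideanSpace ℝ (Fin 3) | z ∈ S ∧ z ≠ y ∧ dist z (y) < 13 / 10 * a} ≃
                       ↥{p : EuclideanSpace ℝ (Fin 3) | p ∈ fccStacking a h ∧ p ≠ 0 ∧ ‖p‖ < 13 / 10 * a},
                     ∀ t : ↥{z : EuclideanSpace ℝ (Fin 3) | z ∈ S ∧ z ≠ y ∧ dist z (y) < 13 / 10 * a},
                       dist ((t : EuclideanSpace ℝ (Fin 3)) - y)
                         (A ((e t : ↥{p : EuclideanSpace ℝ (Fin 3) | p ∈ fccStacking a h ∧ p ≠ 0 ∧ ‖p‖ < 13 / 10 * a}) : EuclideanSpace ℝ (Fin 3))) ≤ τ)) →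
                (hcpPeriodicConfiguration ha hh).energyPerParticle lennardJones + κ
                  ≤ 1 / 2 * (∑' z : {z // z ∈ S ∧ z ≠ y}, lennardJones (dist y z.1))
                      + ∑' z : {z // z ∈ S ∧ z ≠ y}, g y z.1))
    (hdiv : ∀ (P : PeriodicConfiguration 3) (g : EuclideanSpace ℝ (Fin 3) → EuclideanSpace ℝ (Fin 3) → ℝ) (G : ℝ),
      (∀ y z, g y z = -g z y) →
      (∀ v ∈ P.lattice, ∀ y z, g (y + v) (z + v) = g y z) →
      (∀ y z, |g y z| ≤ G * (dist y z)⁻¹ ^ 6) →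
      ∑ y ∈ P.motif, ∑' z : {z // z ∈ P.points ∧ z ≠ y}, g y z.1 = 0)
    (hfloor : ∀ G : ℝ, 0 ≤ G → ∃ C₀ : ℝ, 0 ≤ C₀ ∧
      ∀ S : Set (EuclideanSpace ℝ (Fin 3)), (∀ u ∈ S, ∀ v ∈ S, u ≠ v → (1 / 3 : ℝ) ≤ dist u v) →
        ∀ g : EuclideanSpace ℝ (Fin 3) → EuclideanSpace ℝ (Fin 3) → ℝ,
          (∀ y z, |g y z| ≤ G * (dist y z)⁻¹ ^ 6) →
          ∀ y ∈ S, -C₀ ≤ 1 / 2 * (∑' z : {z // z ∈ S ∧ z ≠ y}, lennardJones (dist y z.1))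
                        + ∑' z : {z // z ∈ S ∧ z ≠ y}, g y z.1) :
    ∀ (a h : ℝ) (ha : a ≠ 0) (hh : h ≠ 0), (9 / 10 < a ∧ a < 1 ∧ |h - a * Real.sqrt (2 / 3)| ≤ a / 100) →
      (∀ a' h' : ℝ, ∀ ha' : a' ≠ 0, ∀ hh' : h' ≠ 0, (9 / 10 < a' ∧ a' < 1 ∧ |h' - a' * Real.sqrt (2 / 3)| ≤ a' / 100) →
        (hcpPeriodicConfiguration ha hh).energyPerParticle lennardJones ≤
          (hcpPeriodicConfiguration ha' hh').energyPerParticle lennardJones) →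
      ∃ R : ℝ, 0 < R ∧ ∃ C : ℝ, 0 ≤ C ∧ ∀ τ : ℝ, 0 < τ → τ ≤ 1 → ∃ c : ℝ, 0 < c ∧
        ∀ P : PeriodicConfiguration 3, (∀ u ∈ P.points, ∀ v ∈ P.points, u ≠ v → (1 / 3 : ℝ) ≤ dist u v) →
          c * ((P.motif.filter fun q => ¬ (∃ A : EuclideanSpace ℝ (Fin 3) →ₗᵢ[ℝ] EuclideanSpace ℝ (Fin 3),
                   (∃ e : ↥{z : EuclideanSpace ℝ (Fin 3) | z ∈ P.points ∧ z ≠ q ∧ dist z (q) < 13 / 10 * a} ≃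
                       ↥{p : EuclideanSpace ℝ (Fin 3) | p ∈ hcpStacking a h ∧ p ≠ 0 ∧ ‖p‖ < 13 / 10 * a},
                     ∀ t : ↥{z : EuclideanSpace ℝ (Fin 3) | z ∈ P.points ∧ z ≠ q ∧ dist z (q) < 13 / 10 * a},
                       dist ((t : EuclideanSpace ℝ (Fin 3)) - q)
                         (A ((e t : ↥{p : EuclideanSpace ℝ (Fin 3) | p ∈ hcpStacking a h ∧ p ≠ 0 ∧ ‖p‖ < 13 / 10 * a}) : EuclideanSpace ℝ (Fin 3))) ≤ τ) ∨
                   (∃ e : ↥{z : EuclideanSpace ℝ (Fin 3) | z ∈ P.points ∧ z ≠ q ∧ dist z (q) < 13 / 10 * a} ≃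
                       ↥{p : EuclideanSpace ℝ (Fin 3) | p ∈ fccStacking a h ∧ p ≠ 0 ∧ ‖p‖ < 13 / 10 * a},
                     ∀ t : ↥{z : EuclideanSpace ℝ (Fin 3) | z ∈ P.points ∧ z ≠ q ∧ dist z (q) < 13 / 10 * a},
                       dist ((t : EuclideanSpace ℝ (Fin 3)) - q)
                         (A ((e t : ↥{p : EuclideanSpace ℝ (Fin 3) | p ∈ fccStacking a h ∧ p ≠ 0 ∧ ‖p‖ < 13 / 10 * a}) : EuclideanSpace ℝ (Fin 3))) ≤ τ)) ∧
                ∀ p ∈ P.points, dist p q ≤ R → IsTwoShellGoodSet (1 / 20) (47 / 50) 1 P.points p).card : ℝ)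
            - C * ((P.motif.filter fun q =>
                ∃ p ∈ P.points, dist p q ≤ R ∧ ¬ IsTwoShellGoodSet (1 / 20) (47 / 50) 1 P.points p).card : ℝ)
          ≤ (P.motif.card : ℝ) *
              (P.energyPerParticle lennardJones - (hcpPeriodicConfiguration ha hh).energyPerParticle lennardJones) := by
  intro a h ha hh hbox hmin
  obtain ⟨R, hR, G, hG, hτ⟩ := hcal a h ha hh hbox hmin
  obtain ⟨C₀, hC₀, hfl⟩ := hfloor G hG
  refine ⟨R, hR, C₀ + |(hcpPeriodicConfiguration ha hh).energyPerParticle lennardJones|, by positivity, ?_⟩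
  intro τ hτ0 hτ1
  obtain ⟨κ, hκ, hS⟩ := hτ τ hτ0 hτ1
  refine ⟨κ, hκ, ?_⟩
  intro P hsep
  obtain ⟨g, hanti, hdec, hcov, hgood, hbad⟩ := hS P.points hsep
  set eh : ℝ := (hcpPeriodicConfiguration ha hh).energyPerParticle lennardJones with heh
  -- the calibrated site functional
  set F : EuclideanSpace ℝ (Fin 3) → ℝ := fun y =>
    1 / 2 * (∑' z : {z // z ∈ P.points ∧ z ≠ y}, lennardJones (dist y z.1))
      + ∑' z : {z // z ∈ P.points ∧ z ≠ y}, g y z.1 with hF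
  -- (i) the divergence vanishes on the torus, so `Σ_motif F = #motif · e(P)`
  have hcovL : ∀ v ∈ P.lattice, ∀ y z, g (y + v) (z + v) = g y z := by
    intro v hv y z
    refine hcov v (fun p => ⟨fun hp => ?_, fun hp => P.add_mem_points hp hv⟩) y z
    have h' := P.add_mem_points hp (P.lattice.neg_mem hv)
    simpa using h'
  have hdiv0 : ∑ y ∈ P.motif, ∑' z : {z // z ∈ P.points ∧ z ≠ y}, g y z.1 = 0 :=
    hdiv P g G hanti hcovL hdec
  have hcard0 : (P.motif.card : ℝ) ≠ 0 := by
    exact_mod_cast (P.motif_nonempty.card_pos).ne'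
  have hsumF : ∑ y ∈ P.motif, F y = (P.motif.card : ℝ) * P.energyPerParticle lennardJones := by
    simp only [hF, Finset.sum_add_distrib, hdiv0, add_zero]
    unfold PeriodicConfiguration.energyPerParticle
    rw [← Finset.mul_sum]
    field_simp
  -- (ii) names for the three finsets of the statement and the deep set
  set IB := (P.motif.filter fun q => ¬ (∃ A : EuclideanSpace ℝ (Fin 3) →ₗᵢ[ℝ] EuclideanSpace ℝ (Fin 3),
                   (∃ e : ↥{z : EuclideanSpace ℝ (Fin 3) | z ∈ P.points ∧ z ≠ q ∧ dist z (q) < 13 / 10 * a} ≃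
                       ↥{p : EuclideanSpace ℝ (Fin 3) | p ∈ hcpStacking a h ∧ p ≠ 0 ∧ ‖p‖ < 13 / 10 * a},
                     ∀ t : ↥{z : EuclideanSpace ℝ (Fin 3) | z ∈ P.points ∧ z ≠ q ∧ dist z (q) < 13 / 10 * a},
                       dist ((t : EuclideanSpace ℝ (Fin 3)) - q)
                         (A ((e t : ↥{p : EuclideanSpace ℝ (Fin 3) | p ∈ hcpStacking a h ∧ p ≠ 0 ∧ ‖p‖ < 13 / 10 * a}) : EuclideanSpace ℝ (Fin 3))) ≤ τ) ∨
                   (∃ e : ↥{z : EuclideanSpace ℝ (Fin 3) | z ∈ P.points ∧ z ≠ q ∧ dist z (q) < 13 / 10 * a} ≃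
                       ↥{p : EuclideanSpace ℝ (Fin 3) | p ∈ fccStacking a h ∧ p ≠ 0 ∧ ‖p‖ < 13 / 10 * a},
                     ∀ t : ↥{z : EuclideanSpace ℝ (Fin 3) | z ∈ P.points ∧ z ≠ q ∧ dist z (q) < 13 / 10 * a},
                       dist ((t : EuclideanSpace ℝ (Fin 3)) - q)
                         (A ((e t : ↥{p : EuclideanSpace ℝ (Fin 3) | p ∈ fccStacking a h ∧ p ≠ 0 ∧ ‖p‖ < 13 / 10 * a}) : EuclideanSpace ℝ (Fin 3))) ≤ τ)) ∧
      ∀ p ∈ P.points, dist p q ≤ R → IsTwoShellGoodSet (1 / 20) (47 / 50) 1 P.points p) with hIBdef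
  set Sp := (P.motif.filter fun q =>
      ∃ p ∈ P.points, dist p q ≤ R ∧ ¬ IsTwoShellGoodSet (1 / 20) (47 / 50) 1 P.points p) with hSpdef
  set Dp := (P.motif.filter fun q =>
      ∀ p ∈ P.points, dist p q ≤ R → IsTwoShellGoodSet (1 / 20) (47 / 50) 1 P.points p) with hDpdef
  -- (iii) pointwise bounds
  have hlow_deep : ∀ y ∈ Dp, eh + (if ¬ (∃ A : EuclideanSpace ℝ (Fin 3) →ₗᵢ[ℝ] EuclideanSpace ℝ (Fin 3),
                   (∃ e : ↥{z : EuclideanSpace ℝ (Fin 3) | z ∈ P.points ∧ z ≠ y ∧ dist z (y) < 13 / 10 * a} ≃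
                       ↥{p : EuclideanSpace ℝ (Fin 3) | p ∈ hcpStacking a h ∧ p ≠ 0 ∧ ‖p‖ < 13 / 10 * a},
                     ∀ t : ↥{z : EuclideanSpace ℝ (Fin 3) | z ∈ P.points ∧ z ≠ y ∧ dist z (y) < 13 / 10 * a},
                       dist ((t : EuclideanSpace ℝ (Fin 3)) - y)
                         (A ((e t : ↥{p : EuclideanSpace ℝ (Fin 3) | p ∈ hcpStacking a h ∧ p ≠ 0 ∧ ‖p‖ < 13 / 10 * a}) : EuclideanSpace ℝ (Fin 3))) ≤ τ) ∨
                   (∃ e : ↥{z : EuclideanSpace ℝ (Fin 3) | z ∈ P.points ∧ z ≠ y ∧ dist z (y) < 13 / 10 * a} ≃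
                       ↥{p : EuclideanSpace ℝ (Fin 3) | p ∈ fccStacking a h ∧ p ≠ 0 ∧ ‖p‖ < 13 / 10 * a},
                     ∀ t : ↥{z : EuclideanSpace ℝ (Fin 3) | z ∈ P.points ∧ z ≠ y ∧ dist z (y) < 13 / 10 * a},
                       dist ((t : EuclideanSpace ℝ (Fin 3)) - y)
                         (A ((e t : ↥{p : EuclideanSpace ℝ (Fin 3) | p ∈ fccStacking a h ∧ p ≠ 0 ∧ ‖p‖ < 13 / 10 * a}) : EuclideanSpace ℝ (Fin 3))) ≤ τ)) then κ else 0) ≤ F y := by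
    intro y hy
    rw [hDpdef, Finset.mem_filter] at hy
    have hyS : y ∈ P.points := P.mem_points_of_mem_motif hy.1
    by_cases hb : ¬ (∃ A : EuclideanSpace ℝ (Fin 3) →ₗᵢ[ℝ] EuclideanSpace ℝ (Fin 3),
                   (∃ e : ↥{z : EuclideanSpace ℝ (Fin 3) | z ∈ P.points ∧ z ≠ y ∧ dist z (y) < 13 / 10 * a} ≃
                       ↥{p : EuclideanSpace ℝ (Fin 3) | p ∈ hcpStacking a h ∧ p ≠ 0 ∧ ‖p‖ < 13 / 10 * a},
                     ∀ t : ↥{z : EuclideanSpace ℝ (Fin 3) | z ∈ P.points ∧ z ≠ y ∧ dist z (y) < 13 / 10 * a},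
                       dist ((t : EuclideanSpace ℝ (Fin 3)) - y)
                         (A ((e t : ↥{p : EuclideanSpace ℝ (Fin 3) | p ∈ hcpStacking a h ∧ p ≠ 0 ∧ ‖p‖ < 13 / 10 * a}) : EuclideanSpace ℝ (Fin 3))) ≤ τ) ∨
                   (∃ e : ↥{z : EuclideanSpace ℝ (Fin 3) | z ∈ P.points ∧ z ≠ y ∧ dist z (y) < 13 / 10 * a} ≃
                       ↥{p : EuclideanSpace ℝ (Fin 3) | p ∈ fccStacking a h ∧ p ≠ 0 ∧ ‖p‖ < 13 / 10 * a},
                     ∀ t : ↥{z : EuclideanSpace ℝ (Fin 3) | z ∈ P.points ∧ z ≠ y ∧ dist z (y) < 13 / 10 * a},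
                       dist ((t : EuclideanSpace ℝ (Fin 3)) - y)
                         (A ((e t : ↥{p : EuclideanSpace ℝ (Fin 3) | p ∈ fccStacking a h ∧ p ≠ 0 ∧ ‖p‖ < 13 / 10 * a}) : EuclideanSpace ℝ (Fin 3))) ≤ τ))
    · rw [if_pos hb]
      exact hbad y hyS hy.2 hb
    · rw [if_neg hb, add_zero]
      exact hgood y hyS hy.2
  have hlow_rest : ∀ y ∈ Sp, -C₀ ≤ F y := by
    intro y hy
    rw [hSpdef, Finset.mem_filter] at hy
    exact hfl P.points hsep g hdec y (P.mem_points_of_mem_motif hy.1)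
  -- (iv) bookkeeping
  have hSp_eq : P.motif.filter (fun q => ¬ ∀ p ∈ P.points, dist p q ≤ R →
      IsTwoShellGoodSet (1 / 20) (47 / 50) 1 P.points p) = Sp := by
    rw [hSpdef]
    refine Finset.filter_congr fun q _ => ?_
    simp only [not_forall, exists_prop]
  have hsplit : ∑ y ∈ P.motif, F y = ∑ y ∈ Dp, F y + ∑ y ∈ Sp, F y := by
    rw [← hSp_eq, hDpdef]
    exact (Finset.sum_filter_add_sum_filter_not P.motif _ F).symm
  have hcardsum : (Dp.card : ℝ) + (Sp.card : ℝ) = (P.motif.card : ℝ) := by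
    rw [← hSp_eq, hDpdef]
    exact_mod_cast Finset.card_filter_add_card_filter_not _
  have hIB_eq : Dp.filter (fun q => ¬ (∃ A : EuclideanSpace ℝ (Fin 3) →ₗᵢ[ℝ] EuclideanSpace ℝ (Fin 3),
                   (∃ e : ↥{z : EuclideanSpace ℝ (Fin 3) | z ∈ P.points ∧ z ≠ q ∧ dist z (q) < 13 / 10 * a} ≃
                       ↥{p : EuclideanSpace ℝ (Fin 3) | p ∈ hcpStacking a h ∧ p ≠ 0 ∧ ‖p‖ < 13 / 10 * a},
                     ∀ t : ↥{z : EuclideanSpace ℝ (Fin 3) | z ∈ P.points ∧ z ≠ q ∧ dist z (q) < 13 / 10 * a},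
                       dist ((t : EuclideanSpace ℝ (Fin 3)) - q)
                         (A ((e t : ↥{p : EuclideanSpace ℝ (Fin 3) | p ∈ hcpStacking a h ∧ p ≠ 0 ∧ ‖p‖ < 13 / 10 * a}) : EuclideanSpace ℝ (Fin 3))) ≤ τ) ∨
                   (∃ e : ↥{z : EuclideanSpace ℝ (Fin 3) | z ∈ P.points ∧ z ≠ q ∧ dist z (q) < 13 / 10 * a} ≃
                       ↥{p : EuclideanSpace ℝ (Fin 3) | p ∈ fccStacking a h ∧ p ≠ 0 ∧ ‖p‖ < 13 / 10 * a},
                     ∀ t : ↥{z : EuclideanSpace ℝ (Fin 3) | z ∈ P.points ∧ z ≠ q ∧ dist z (q) < 13 / 10 * a},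
                       dist ((t : EuclideanSpace ℝ (Fin 3)) - q)
                         (A ((e t : ↥{p : EuclideanSpace ℝ (Fin 3) | p ∈ fccStacking a h ∧ p ≠ 0 ∧ ‖p‖ < 13 / 10 * a}) : EuclideanSpace ℝ (Fin 3))) ≤ τ))) = IB := by
    rw [hDpdef, hIBdef, Finset.filter_filter]
    refine Finset.filter_congr fun q _ => ?_
    tauto
  have h1 : (Dp.card : ℝ) * eh + κ * (IB.card : ℝ) ≤ ∑ y ∈ Dp, F y := by
    have h := Finset.sum_le_sum hlow_deep
    rw [Finset.sum_add_distrib, Finset.sum_const, nsmul_eq_mul, Finset.sum_ite, Finset.sum_const_zero,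
      add_zero, Finset.sum_const, nsmul_eq_mul, hIB_eq] at h
    linarith
  have h2 : -C₀ * (Sp.card : ℝ) ≤ ∑ y ∈ Sp, F y := by
    have h := Finset.sum_le_sum hlow_rest
    rw [Finset.sum_const, nsmul_eq_mul] at h
    linarith
  have hSp0 : (0 : ℝ) ≤ (Sp.card : ℝ) := Nat.cast_nonneg _
  have hprod : eh * (Sp.card : ℝ) ≤ |eh| * (Sp.card : ℝ) :=
    mul_le_mul_of_nonneg_right (le_abs_self eh) hSp0
  have hNeh : (P.motif.card : ℝ) * eh = (Dp.card : ℝ) * eh + (Sp.card : ℝ) * eh := by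
    rw [← hcardsum]; ring
  have hgoal : κ * (IB.card : ℝ) - (C₀ + |eh|) * (Sp.card : ℝ)
      ≤ (P.motif.card : ℝ) * P.energyPerParticle lennardJones - (P.motif.card : ℝ) * eh := by
    linarith [hsumF, hsplit, h1, h2, hprod, hNeh]
  linarith [hgoal]

/-- **CSI ⇒ interior relative ledger at every box minimiser** (the two bookkeeping stubs discharged by their
landed tree versions p172565, p172604). [folklore] -/
theorem interiorLedgerAt_of_calibratedSiteInequality
    (hcal :
    ∀ (a h : ℝ) (ha : a ≠ 0) (hh : h ≠ 0), (9 / 10 < a ∧ a < 1 ∧ |h - a * Real.sqrt (2 / 3)| ≤ a / 100) →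
      (∀ a' h' : ℝ, ∀ ha' : a' ≠ 0, ∀ hh' : h' ≠ 0, (9 / 10 < a' ∧ a' < 1 ∧ |h' - a' * Real.sqrt (2 / 3)| ≤ a' / 100) →
        (hcpPeriodicConfiguration ha hh).energyPerParticle lennardJones ≤
          (hcpPeriodicConfiguration ha' hh').energyPerParticle lennardJones) →
      ∃ R : ℝ, 0 < R ∧ ∃ G : ℝ, 0 ≤ G ∧ ∀ τ : ℝ, 0 < τ → τ ≤ 1 → ∃ κ : ℝ, 0 < κ ∧
        ∀ S : Set (EuclideanSpace ℝ (Fin 3)), (∀ u ∈ S, ∀ v ∈ S, u ≠ v → (1 / 3 : ℝ) ≤ dist u v) →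
          ∃ g : EuclideanSpace ℝ (Fin 3) → EuclideanSpace ℝ (Fin 3) → ℝ,
            (∀ y z, g y z = -g z y) ∧
            (∀ y z, |g y z| ≤ G * (dist y z)⁻¹ ^ 6) ∧
            (∀ v : EuclideanSpace ℝ (Fin 3), (∀ p, p + v ∈ S ↔ p ∈ S) → ∀ y z, g (y + v) (z + v) = g y z) ∧
            (∀ y ∈ S, (∀ p ∈ S, dist p y ≤ R → IsTwoShellGoodSet (1 / 20) (47 / 50) 1 S p) →
                (hcpPeriodicConfiguration ha hh).energyPerParticle lennardJones
                  ≤ 1 / 2 * (∑' z : {z // z ∈ S ∧ z ≠ y}, lennardJones (dist y z.1))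
                      + ∑' z : {z // z ∈ S ∧ z ≠ y}, g y z.1) ∧
            (∀ y ∈ S, (∀ p ∈ S, dist p y ≤ R → IsTwoShellGoodSet (1 / 20) (47 / 50) 1 S p) →
                ¬ (∃ A : EuclideanSpace ℝ (Fin 3) →ₗᵢ[ℝ] EuclideanSpace ℝ (Fin 3),
                   (∃ e : ↥{z : EuclideanSpace ℝ (Fin 3) | z ∈ S ∧ z ≠ y ∧ dist z (y) < 13 / 10 * a} ≃
                       ↥{p : EuclideanSpace ℝ (Fin 3) | p ∈ hcpStacking a h ∧ p ≠ 0 ∧ ‖p‖ < 13 / 10 * a},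
                     ∀ t : ↥{z : EuclideanSpace ℝ (Fin 3) | z ∈ S ∧ z ≠ y ∧ dist z (y) < 13 / 10 * a},
                       dist ((t : EuclideanSpace ℝ (Fin 3)) - y)
                         (A ((e t : ↥{p : EuclideanSpace ℝ (Fin 3) | p ∈ hcpStacking a h ∧ p ≠ 0 ∧ ‖p‖ < 13 / 10 * a}) : EuclideanSpace ℝ (Fin 3))) ≤ τ) ∨
                   (∃ e : ↥{z : EuclideanSpace ℝ (Fin 3) | z ∈ S ∧ z ≠ y ∧ dist z (y) < 13 / 10 * a} ≃
                       ↥{p : EuclideanSpace ℝ (Fin 3) | p ∈ fccStacking a h ∧ p ≠ 0 ∧ ‖p‖ < 13 / 10 * a},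
                     ∀ t : ↥{z : EuclideanSpace ℝ (Fin 3) | z ∈ S ∧ z ≠ y ∧ dist z (y) < 13 / 10 * a},
                       dist ((t : EuclideanSpace ℝ (Fin 3)) - y)
                         (A ((e t : ↥{p : EuclideanSpace ℝ (Fin 3) | p ∈ fccStacking a h ∧ p ≠ 0 ∧ ‖p‖ < 13 / 10 * a}) : EuclideanSpace ℝ (Fin 3))) ≤ τ)) →
                (hcpPeriodicConfiguration ha hh).energyPerParticle lennardJones + κ
                  ≤ 1 / 2 * (∑' z : {z // z ∈ S ∧ z ≠ y}, lennardJones (dist y z.1))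
                      + ∑' z : {z // z ∈ S ∧ z ≠ y}, g y z.1)) :
    ∀ (a h : ℝ) (ha : a ≠ 0) (hh : h ≠ 0), (9 / 10 < a ∧ a < 1 ∧ |h - a * Real.sqrt (2 / 3)| ≤ a / 100) →
      (∀ a' h' : ℝ, ∀ ha' : a' ≠ 0, ∀ hh' : h' ≠ 0, (9 / 10 < a' ∧ a' < 1 ∧ |h' - a' * Real.sqrt (2 / 3)| ≤ a' / 100) →
        (hcpPeriodicConfiguration ha hh).energyPerParticle lennardJones ≤
          (hcpPeriodicConfiguration ha' hh').energyPerParticle lennardJones) →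
      ∃ R : ℝ, 0 < R ∧ ∃ C : ℝ, 0 ≤ C ∧ ∀ τ : ℝ, 0 < τ → τ ≤ 1 → ∃ c : ℝ, 0 < c ∧
        ∀ P : PeriodicConfiguration 3, (∀ u ∈ P.points, ∀ v ∈ P.points, u ≠ v → (1 / 3 : ℝ) ≤ dist u v) →
          c * ((P.motif.filter fun q => ¬ (∃ A : EuclideanSpace ℝ (Fin 3) →ₗᵢ[ℝ] EuclideanSpace ℝ (Fin 3),
                   (∃ e : ↥{z : EuclideanSpace ℝ (Fin 3) | z ∈ P.points ∧ z ≠ q ∧ dist z (q) < 13 / 10 * a} ≃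
                       ↥{p : EuclideanSpace ℝ (Fin 3) | p ∈ hcpStacking a h ∧ p ≠ 0 ∧ ‖p‖ < 13 / 10 * a},
                     ∀ t : ↥{z : EuclideanSpace ℝ (Fin 3) | z ∈ P.points ∧ z ≠ q ∧ dist z (q) < 13 / 10 * a},
                       dist ((t : EuclideanSpace ℝ (Fin 3)) - q)
                         (A ((e t : ↥{p : EuclideanSpace ℝ (Fin 3) | p ∈ hcpStacking a h ∧ p ≠ 0 ∧ ‖p‖ < 13 / 10 * a}) : EuclideanSpace ℝ (Fin 3))) ≤ τ) ∨
                   (∃ e : ↥{z : EuclideanSpace ℝ (Fin 3) | z ∈ P.points ∧ z ≠ q ∧ dist z (q) < 13 / 10 * a} ≃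
                       ↥{p : EuclideanSpace ℝ (Fin 3) | p ∈ fccStacking a h ∧ p ≠ 0 ∧ ‖p‖ < 13 / 10 * a},
                     ∀ t : ↥{z : EuclideanSpace ℝ (Fin 3) | z ∈ P.points ∧ z ≠ q ∧ dist z (q) < 13 / 10 * a},
                       dist ((t : EuclideanSpace ℝ (Fin 3)) - q)
                         (A ((e t : ↥{p : EuclideanSpace ℝ (Fin 3) | p ∈ fccStacking a h ∧ p ≠ 0 ∧ ‖p‖ < 13 / 10 * a}) : EuclideanSpace ℝ (Fin 3))) ≤ τ)) ∧
                ∀ p ∈ P.points, dist p q ≤ R → IsTwoShellGoodSet (1 / 20) (47 / 50) 1 P.points p).card : ℝ)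
            - C * ((P.motif.filter fun q =>
                ∃ p ∈ P.points, dist p q ≤ R ∧ ¬ IsTwoShellGoodSet (1 / 20) (47 / 50) 1 P.points p).card : ℝ)
          ≤ (P.motif.card : ℝ) *
              (P.energyPerParticle lennardJones - (hcpPeriodicConfiguration ha hh).energyPerParticle lennardJones) :=
  interiorLedgerAt_of_calibration hcal SummedShellPricingTorusDivergence.stub_torusDivergence
    SummedShellPricingCalibratedFloor.stub_calibratedFloor

end Summit.AtomisticToContinuum.Crystallization.Theorems.SummedShellPricingCalibration

end
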